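import Summits.AnomalousDissipation.AnomalousDissipation.Theses.DyadicWallCascade
import Summits.AnomalousDissipation.AnomalousDissipation.Theses.CoherentStates

/-!
# Sketch — crux-ideate, ideator 2, round 1: first lemmas of three crux ideas for
# `DyadicWallCascade.DyadicRealisation` (stmt-AnomalousDissipation-17918)

§0  bookkeeping: the crux is `ViscousWallProfile → CoherentStates.SteadyZerothLaw` by `Iff.rfl`, and how a
    transferred statement composes with it.
§A  card `baire-soft-closing`: `RobustApproxLoudSteady`, `InverseDesignSteady`, `IsolatedDegeneracyAlongRay`,
    `PersistenceOfNondegenerate`, `BaireReduction` (first lemma), composition with the crux (proved).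
§B  card `time-of-flight-weights`: `WeightedTransportCoercivity` (first lemma; compact-support form on ℝ³).
§C  card `solenoid-limit-periodic-cap`: `HasDyadicAlmostPeriodsOnSlabs`, `PeriodisedInnerApproximants`
    (first lemma).
Typed over existing declarations only; nothing here is proposed to the tree.
-/

noncomputable section

-- mandated summit-side namespace repeats `AnomalousDissipation` (single-conjunct summit)
set_option linter.dupNamespace false

namespace Summit.AnomalousDissipation.AnomalousDissipation.Cruxes.DyadicRealisation.SketchIdeator2

open MeasureTheory Filter Set
open scoped InnerProductSpace Topology BigOperators
open Literature.Analysis.FunctionSpaces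
open Summit.AnomalousDissipation.AnomalousDissipation.Theses

local notation "𝕋³" => UnitAddTorus (Fin 3)
local notation "E³" => EuclideanSpace ℝ (Fin 3)

/-! ## §0 Bookkeeping -/

/-- The crux, definitionally: bare existence of a viscous wall profile implies the steady zeroth law
(stmt-0219 verbatim). -/
theorem dyadicRealisation_iff :
    DyadicWallCascade.DyadicRealisation ↔
      (DyadicWallCascade.ViscousWallProfile → CoherentStates.SteadyZerothLaw) :=
  Iff.rfl

/-! ## §A Card `baire-soft-closing` -/

/-- Pointwise steady Navier–Stokes residual of a pair `(u, q)` at viscosity `ν` against a force `g`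
on `T³`: `(u·∇)u − νΔu + ∇q − g` (zero iff `(u, q)` is a classical steady state forced by `g`). -/
def steadyResidual (ν : ℝ) (u : 𝕋³ → E³) (q : 𝕋³ → ℝ) (g : 𝕋³ → E³) : 𝕋³ → E³ :=
  fun x => Torus.convect u u x - ν • Torus.laplacian u x + Torus.gradient q x - g x

/-- `C^k`-smallness of a field on `T³` through its lattice-periodic lift: all derivatives of order
`≤ k` are bounded by `η` everywhere (the seminorm balls of the Fréchet space `C^∞(T³; ℝ³)`). -/
def CkSmall (k : ℕ) (r : 𝕋³ → E³) (η : ℝ) : Prop :=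
  ∀ n : ℕ, n ≤ k → ∀ y : E³, ‖iteratedFDeriv ℝ n (Torus.lift r) y‖ ≤ η

/-- ROBUST APPROXIMATE LOUD STEADY STATES near one pump `f⋆` (the transferred statement C⁺ of the card,
minus its antecedent): there are a smooth admissible pump `f⋆`, an order `k₀`, a radius `ρ > 0`
and budgets `E`, `ε > 0` such that for EVERY smooth admissible perturbation `h` with `‖h‖_{C^{k₀}} ≤ ρ`,
every order `k`, tolerance `η > 0` and viscosity cap `ν₀ > 0` there are a viscosity
`0 < ν < ν₀` and a smooth divergence-free approximate steady state `(u, q)` for the force `f⋆ + h`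
with `∫|u|² < E`, `ν‖∇u‖² > ε` and `‖(u·∇)u − νΔu + ∇q − (f⋆ + h)‖_{C^k} ≤ η`.
No exactness, no nondegeneracy, no resolvent bound is asked; residuals must vanish in every `C^k`
(the Fréchet topology of `C^∞`, forced because the final force must be smooth) along some
viscosities `ν → 0`, robustly in the pump. -/
def RobustApproxLoudSteady : Prop :=
  ∃ (fs : 𝕋³ → E³) (k₀ : ℕ) (ρ E ε : ℝ),
    Torus.IsSmooth fs ∧ Torus.IsDivFree fs ∧ Torus.HasZeroMean fs ∧ 0 < ρ ∧ 0 < ε ∧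
    ∀ h : 𝕋³ → E³, Torus.IsSmooth h → Torus.IsDivFree h → Torus.HasZeroMean h →
      CkSmall k₀ h ρ →
      ∀ (k : ℕ) (η ν₀ : ℝ), 0 < η → 0 < ν₀ →
        ∃ (ν : ℝ) (u : 𝕋³ → E³) (q : 𝕋³ → ℝ),
          0 < ν ∧ ν < ν₀ ∧ Torus.IsSmooth u ∧ Torus.IsSmooth q ∧ Torus.IsDivFree u ∧
          Torus.HasZeroMean u ∧ (∫ x, ‖u x‖ ^ 2) < E ∧ ε < ν * Torus.gradNormSq u ∧
          CkSmall k (steadyResidual ν u q (fun x => fs x + h x)) η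

/-- INVERSE DESIGN (provable now from `Torus.smooth_helmholtz`): every smooth divergence-free field
`u` is an EXACT classical steady state of `NS_ν` for the smooth, divergence-free, mean-zero "designer
force" `g = ℙ[(u·∇)u − νΔu]`; moreover `g − f₀` is the Leray part of the residual of `(u, q)`
against any admissible `f₀` (so `‖g − f₀‖_{C^k} ≲ ‖residual‖_{C^{k+2}}`: small residual ⇒ nearby
EXACT designer force). -/
def InverseDesignSteady : Prop :=
  ∀ (ν : ℝ) (u : 𝕋³ → E³) (q : 𝕋³ → ℝ) (f₀ : 𝕋³ → E³), Torus.IsSmooth u → Torus.IsDivFree u →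
    Torus.IsSmooth q → Torus.IsSmooth f₀ → Torus.IsDivFree f₀ → Torus.HasZeroMean f₀ →
    ∃ (g : 𝕋³ → E³) (p : 𝕋³ → ℝ) (φ : 𝕋³ → ℝ), Torus.IsSmooth g ∧ Torus.IsDivFree g ∧
      Torus.HasZeroMean g ∧ Torus.IsSmooth φ ∧
      Torus.IsClassicalNSSolutionOn Set.univ ν (fun _ => g) (fun _ => u) (fun _ => p) ∧
      ∀ x, g x - f₀ x = steadyResidual ν u q f₀ x - Torus.gradient φ x

/-- The smooth kernel of the linearised steady operator at `w` (viscosity `ν`) is trivial: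
no smooth divergence-free mean-zero `v ≠ 0` and smooth `r` with
`(w·∇)v + (v·∇)w − νΔv + ∇r = 0`. (For the Fredholm-index-0 steady operator on `T³` this is
nondegeneracy.) -/
def SteadyKernelTrivial (ν : ℝ) (w : 𝕋³ → E³) : Prop :=
  ∀ (v : 𝕋³ → E³) (r : 𝕋³ → ℝ), Torus.IsSmooth v → Torus.IsDivFree v → Torus.HasZeroMean v →
    Torus.IsSmooth r →
    (∀ x, Torus.convect w v x + Torus.convect v w x - ν • Torus.laplacian v x + Torus.gradient r x = 0) →
    ∀ x, v x = 0

/-- ISOLATED DEGENERACY ALONG THE RAY `t ↦ t • u` (analytic Fredholm theory: the linearisation at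
`t • u` is `νA(I + tK)` with `K` compact on `H²_σ`, invertible at `t = 0`): for `ν > 0` and smooth
divergence-free `u`, only finitely many `t ∈ [0, 1]` make `t • u` degenerate. This is what makes
force-OPENNESS of "loud nondegenerate steady state" FREE for steady witnesses. -/
def IsolatedDegeneracyAlongRay : Prop :=
  ∀ (ν : ℝ) (u : 𝕋³ → E³), 0 < ν → Torus.IsSmooth u → Torus.IsDivFree u → Torus.HasZeroMean u →
    {t : ℝ | t ∈ Set.Icc (0 : ℝ) 1 ∧ ¬ SteadyKernelTrivial ν (fun x => t • u x)}.Finite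

/-- PERSISTENCE (implicit function theorem for the steady problem at fixed `ν > 0`, Literature-grade):
a nondegenerate classical steady state persists, with its strict energy and dissipation budgets,
under every `L²`-small smooth admissible change of the force. -/
def PersistenceOfNondegenerate : Prop :=
  ∀ (ν : ℝ) (f u : 𝕋³ → E³) (p : 𝕋³ → ℝ) (E ε : ℝ), 0 < ν →
    Torus.IsSmooth f → Torus.IsDivFree f → Torus.HasZeroMean f →
    Torus.IsClassicalNSSolutionOn Set.univ ν (fun _ => f) (fun _ => u) (fun _ => p) →
    Torus.HasZeroMean u → SteadyKernelTrivial ν u →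
    (∫ x, ‖u x‖ ^ 2) < E → ε < ν * Torus.gradNormSq u →
    ∃ δ : ℝ, 0 < δ ∧ ∀ f' : 𝕋³ → E³, Torus.IsSmooth f' → Torus.IsDivFree f' → Torus.HasZeroMean f' →
      (∫ x, ‖f' x - f x‖ ^ 2) < δ ^ 2 →
      ∃ (u' : 𝕋³ → E³) (p' : 𝕋³ → ℝ),
        Torus.IsClassicalNSSolutionOn Set.univ ν (fun _ => f') (fun _ => u') (fun _ => p') ∧
        Torus.HasZeroMean u' ∧ (∫ x, ‖u' x‖ ^ 2) < E ∧ ε < ν * Torus.gradNormSq u'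

/-- FIRST LEMMA of card `baire-soft-closing` — the BAIRE REDUCTION: robust approximate loud steady
states near one pump already give the steady zeroth law (0219 verbatim), by Baire category in the
Fréchet space of smooth admissible forces: `G_M := {f : loud nondegenerate steady state at some
ν ≤ 2^{-M}}` is open (`PersistenceOfNondegenerate`) and dense in the `ρ`-ball
(`RobustApproxLoudSteady` + `InverseDesignSteady` + `IsolatedDegeneracyAlongRay`), so `⋂_M G_M ≠ ∅`. -/
def BaireReduction : Prop :=
  RobustApproxLoudSteady → CoherentStates.SteadyZerothLaw

/-- Composition with the crux (checked): the line is `BaireReduction` (soft, W-free) plus the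
W-dependent transferred crux `ViscousWallProfile → RobustApproxLoudSteady`. -/
theorem dyadicRealisation_of_baire (h₁ : BaireReduction)
    (h₂ : DyadicWallCascade.ViscousWallProfile → RobustApproxLoudSteady) :
    DyadicWallCascade.DyadicRealisation := by
  rw [dyadicRealisation_iff]
  exact fun hW => h₁ (h₂ hW)

/-! ## §B Card `time-of-flight-weights` -/

/-- FIRST LEMMA of card `time-of-flight-weights` — TRANSPORT–STRAIN COERCIVITY UNDER A LYAPUNOV
WEIGHT (compact-support form on an open set `Ω ⊆ ℝ³`, no pressure): if `ū` is smooth and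
divergence free on `Ω`, `σ ≥ 0` majorises the strain (`|⟪(w·∇)ū, w⟫| ≤ σ|w|²`), and the smooth
weight `φ > 0` decays along the flow at the local strain rate, `ū·∇φ ≤ −κσφ` (a time-of-flight
weight `φ = exp(−κ∫σ dτ)` exists exactly on wall-to-wall THROUGH-FLOW regions), then for every
smooth `v` compactly supported in `Ω`
`(κ/2 − 1) ∫ φσ|v|² ≤ ∫ φ ⟪(ū·∇)v + (v·∇)ū, v⟫`
(transport term `= −½∫|v|² ū·∇φ` after integrating by parts with `div ū = 0`). With `κ > 2` the
linearised steady operator is coercive in `L²(φ)` up to the pressure commutator and `−νΔ`; the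
price is the weight ratio `sup φ / inf φ = exp(κ · strain exposure)`. -/
def WeightedTransportCoercivity : Prop :=
  ∀ (Ω : Set E³) (ub v : E³ → E³) (φ σ : E³ → ℝ) (κ : ℝ), IsOpen Ω →
    ContDiffOn ℝ ((⊤ : ℕ∞) : WithTop ℕ∞) ub Ω → ContDiff ℝ ((⊤ : ℕ∞) : WithTop ℕ∞) v →
    ContDiffOn ℝ ((⊤ : ℕ∞) : WithTop ℕ∞) φ Ω →
    HasCompactSupport v → tsupport v ⊆ Ω →
    (∀ X ∈ Ω, ∑ i : Fin 3, (fderiv ℝ ub X (EuclideanSpace.single i (1 : ℝ))) i = 0) →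
    (∀ X ∈ Ω, 0 < φ X) → (∀ X ∈ Ω, 0 ≤ σ X) →
    (∀ X ∈ Ω, ∀ w : E³, |⟪(fderiv ℝ ub X) w, w⟫_ℝ| ≤ σ X * ‖w‖ ^ 2) →
    (∀ X ∈ Ω, (fderiv ℝ φ X) (ub X) ≤ -(κ * σ X * φ X)) →
    (κ / 2 - 1) * ∫ X, φ X * σ X * ‖v X‖ ^ 2 ≤
      ∫ X, φ X * ⟪(fderiv ℝ v X) (ub X) + (fderiv ℝ ub X) (v X), v X⟫_ℝ

/-! ## §C Card `solenoid-limit-periodic-cap` -/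

/-- `2^m e₀, 2^m e₁` are `δ`-almost periods of `W` on the slab `|X₂| ≤ Z` for INFINITELY MANY `m`
(the exact property cut-and-paste inner approximants need; implied by dyadic limit-periodicity per
height slab = continuity of the cap on the 2-adic solenoidal hull; NOT implied by bare existence of
the profile). -/
def HasDyadicAlmostPeriodsOnSlabs {F : Type*} [NormedAddCommGroup F] (W : E³ → F) : Prop :=
  ∀ Z δ : ℝ, 0 < δ → ∀ m₀ : ℕ, ∃ m : ℕ, m₀ ≤ m ∧ ∀ X : E³, |X 2| ≤ Z →
    ‖W (X + (2 : ℝ) ^ m • EuclideanSpace.single (0 : Fin 3) (1 : ℝ)) - W X‖ ≤ δ ∧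
    ‖W (X + (2 : ℝ) ^ m • EuclideanSpace.single (1 : Fin 3) (1 : ℝ)) - W X‖ ≤ δ

/-- Force-free steady Navier–Stokes residual at unit viscosity on `ℝ³` (clauses as in the route file):
`(U·∇)U + ∇R − ΔU`. -/
def nsResidual (U : E³ → E³) (R : E³ → ℝ) (X : E³) : E³ :=
  (fderiv ℝ U X) (U X) + gradient R X -
    ∑ i : Fin 3, fderiv ℝ (fun Y => fderiv ℝ U Y (EuclideanSpace.single i (1 : ℝ))) X
      (EuclideanSpace.single i (1 : ℝ))

/-- FIRST LEMMA of card `solenoid-limit-periodic-cap` — PERIODISED INNER APPROXIMANTS: a bounded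
smooth entire force-free steady NS pair `(W, P)` (mirror-symmetric, divergence free) whose velocity
AND pressure have dyadic almost periods on slabs admits, for every slab height `Z`, tolerance `δ` and
infinitely many `m`, an EXACTLY `2^m`-biperiodic, smooth, divergence-free, mirror-symmetric pair
`(U, R)` that is `δ`-close to `W` on the central quarter cell of the slab and has force-free steady
NS residual `≤ δ` on the whole slab (cut-off periodisation on scale `2^m`, Bogovskiĭ correction of
the `O(2^{-m})` divergence defect, interior regularity to upgrade `C⁰` almost periods to `C²`). -/
def PeriodisedInnerApproximants : Prop :=
  ∀ (W : E³ → E³) (P : E³ → ℝ) (C' : ℝ),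
    let e : Fin 3 → E³ := fun i => EuclideanSpace.single i (1 : ℝ)
    let σ : E³ → E³ := fun X => X - (2 * X 2) • e 2
    ContDiff ℝ ((⊤ : ℕ∞) : WithTop ℕ∞) W → ContDiff ℝ ((⊤ : ℕ∞) : WithTop ℕ∞) P →
    (∀ X, ‖W X‖ ≤ C' ∧ |P X| ≤ C') → (∀ X, W (σ X) = σ (W X) ∧ P (σ X) = P X) →
    (∀ X, ∑ i : Fin 3, (fderiv ℝ W X (e i)) i = 0) → (∀ X, nsResidual W P X = 0) →
    HasDyadicAlmostPeriodsOnSlabs W → HasDyadicAlmostPeriodsOnSlabs P →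
    ∀ Z δ : ℝ, 0 < Z → 0 < δ → ∀ m₀ : ℕ, ∃ m : ℕ, m₀ ≤ m ∧
      ∃ (U : E³ → E³) (R : E³ → ℝ),
        ContDiff ℝ ((⊤ : ℕ∞) : WithTop ℕ∞) U ∧ ContDiff ℝ ((⊤ : ℕ∞) : WithTop ℕ∞) R ∧
        (∀ X, U (X + (2 : ℝ) ^ m • e 0) = U X ∧ U (X + (2 : ℝ) ^ m • e 1) = U X ∧
          R (X + (2 : ℝ) ^ m • e 0) = R X ∧ R (X + (2 : ℝ) ^ m • e 1) = R X) ∧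
        (∀ X, U (σ X) = σ (U X) ∧ R (σ X) = R X) ∧
        (∀ X, ∑ i : Fin 3, (fderiv ℝ U X (e i)) i = 0) ∧
        (∀ X : E³, |X 0| ≤ (2 : ℝ) ^ m / 4 → |X 1| ≤ (2 : ℝ) ^ m / 4 → |X 2| ≤ Z → ‖U X - W X‖ ≤ δ) ∧
        (∀ X : E³, |X 2| ≤ Z → ‖nsResidual U R X‖ ≤ δ)

end Summit.AnomalousDissipation.AnomalousDissipation.Cruxes.DyadicRealisation.SketchIdeator2

end
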